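import Summits.ResolutionOfSingularities.ResolutionOfSingularities.Theorems.FrobeniusLadderFRationalResolutionSubstitutionSafeRays
import Mathlib.RingTheory.Ideal.Maps
import HarnessLib

/-!
# Crux `FrobeniusLadder.FRationalResolution` (stmt-ResolutionOfSingularities-15317), line `redirect`,
# stub `stub_diagonalizableQuotientResolution` — a SYMMETRIC SAFE-RAY CENTRE IS CARRIED INTO ITSELF (lane W‴ capstone, algebra side)

`…SubstitutionSafeRays.map_prod_mem_span_of_safe_rays` (✓ p829976) controls the image of ONE monomial, read through the weight permutation
`π`, under a ring map `θ` of the shape produced by the comparison of two cover structures (`θ (y l) ∈ (z^{u'} : wt u' = c (π l))`). Here the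
statement is closed up into the form the descent datum (`…DescentDatumCentre`, ✓ p827270) consumes: if the set of rays is stable under reading
through `π` (`v ↦ v ∘ π`) and the order function `f` is `π`-invariant on it — i.e. the fan and its support function are symmetric under the
weight permutation — then **`θ` maps the whole monomial centre `J_f = (y^U : f v ≤ ⟨U, v⟩ ∀ v ∈ rays)` into the same centre in the other
parameters `z`**:

* `count_sum_replicate` — bookkeeping: the factor list `Σ_l (U l) · {l}` has exponent vector `U`;
* **`map_span_centre_le_span_centre`** — `θ (J_f^{(y)}) ⊆ J_f^{(z)}` for a `π`-stable set of substitution-safe rays and a `π`-invariant `f`.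

Honest label: elementary algebra for the DESIGN W‴ (memo MEMO-15317-leafhand4-g5: intrinsic centres from Γ-symmetric safe-ray fans; evidence
1421/1421 isolated cyclic quotient singularities in dimensions 3–5); its consumers (the cover comparison W2 producing `θ`, the ladder theorem
producing the fan) are NOT in the tree. No stub closed by name. No definitions, no named facts, no sorry.
[folklore; cite: KempfEtAl1973, Ch. I §2 Thm. 11] [cite: Fulton1993Toric, §2.6]
-/

-- single-problem summit: the doubled namespace component is forced
set_option linter.dupNamespace false

namespace Summit.ResolutionOfSingularities.ResolutionOfSingularities.Theorems.FRationalResolution.SafeRayCentreStable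

open Finset
open Summit.ResolutionOfSingularities.ResolutionOfSingularities.Theorems.FRationalResolution.SubstitutionClosedCentres
open Summit.ResolutionOfSingularities.ResolutionOfSingularities.Theorems.FRationalResolution.SubstitutionSafeRays

variable {n : ℕ} {A : Type} [AddCommGroup A]

/-- Bookkeeping: the factor list `Σ_l (U l) · {l}` (each index `l` repeated `U l` times) has exponent vector `U`. [folklore] -/
theorem count_sum_replicate (U : Fin n → ℕ) (l : Fin n) :
    (∑ l', Multiset.replicate (U l') l').count l = U l := by
  rw [Multiset.count_sum']
  simp_rw [Multiset.count_replicate]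
  simp

/-- **A symmetric safe-ray centre is carried into itself (lane W‴ capstone).** Weights `c : Fin n → A`, a weight permutation
`π`, a set `rays` of substitution-safe rays stable under `v ↦ v ∘ π`, and an order function `f` with `f (v ∘ π) = f v` on `rays`. Let
`θ : E → E'` be a ring map with `θ (y l) ∈ (z^{u'} : Σ u' i • c i = c (π l))` for every `l` (the shape of the comparison of two cover
structures at an off-diagonal point). Then `θ` maps the monomial centre `(y^U : ∀ v ∈ rays, f v ≤ ⟨U, v⟩)` into the centre
`(z^U : ∀ v ∈ rays, f v ≤ ⟨U, v⟩)`. [folklore; cite: KempfEtAl1973, Ch. I §2 Thm. 11] -/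
theorem map_span_centre_le_span_centre {E E' : Type} [CommRing E] [CommRing E'] (θ : E →+* E')
    (y : Fin n → E) (z : Fin n → E') (c : Fin n → A) (π : Equiv.Perm (Fin n)) (rays : Set (Fin n → ℚ))
    (hsafe : ∀ v ∈ rays, ∀ (u : Fin n → ℕ) (l₀ : Fin n), ∑ l, u l • c l = c l₀ → v l₀ ≤ ∑ l, (u l : ℚ) * v l)
    (hrays : ∀ v ∈ rays, (fun l => v (π l)) ∈ rays)
    (f : (Fin n → ℚ) → ℚ) (hf : ∀ v ∈ rays, f (fun l => v (π l)) = f v)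
    (hθ : ∀ l, θ (y l) ∈
      Ideal.span ((fun u : Fin n → ℕ => ∏ i, z i ^ u i) '' {u | ∑ i, u i • c i = c (π l)})) :
    Ideal.map θ (Ideal.span ((fun U : Fin n → ℕ => ∏ i, y i ^ U i) ''
        {U | ∀ v ∈ rays, f v ≤ ∑ i, (U i : ℚ) * v i})) ≤
      Ideal.span ((fun U : Fin n → ℕ => ∏ i, z i ^ U i) ''
        {U | ∀ v ∈ rays, f v ≤ ∑ i, (U i : ℚ) * v i}) := by
  classical
  rw [Ideal.map_span]
  refine Ideal.span_le.mpr ?_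
  rintro _ ⟨_, ⟨U, hU, rfl⟩, rfl⟩
  -- the generator `y^U` as the product of a factor list
  set m : Multiset (Fin n) := ∑ l', Multiset.replicate (U l') l' with hm
  have hcount : ∀ l, m.count l = U l := fun l => by rw [hm]; exact count_sum_replicate U l
  have hprod : (m.map y).prod = ∏ i, y i ^ U i := by
    rw [prod_map_eq_prod_pow_count]
    exact Finset.prod_congr rfl fun l _ => by rw [hcount]
  show θ (∏ i, y i ^ U i) ∈ _
  rw [← hprod]
  refine map_prod_mem_span_of_safe_rays θ y z c π rays hsafe f hθ m ?_
  -- the order conditions for `m` read through `π` are those for `U` against `v ∘ π ∈ rays`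
  intro v hv
  rw [sum_map_map_eq_sum_count]
  have hc2 : ∀ l, (m.map (π : Fin n → Fin n)).count l = U (π.symm l) := by
    intro l
    have h := Multiset.count_map_eq_count' (π : Fin n → Fin n) m π.injective (π.symm l)
    rw [Equiv.apply_symm_apply] at h
    rw [h, hcount]
  simp_rw [hc2]
  have hre : ∑ l, (U (π.symm l) : ℚ) * v l = ∑ l, (U l : ℚ) * v (π l) := by
    rw [← Equiv.sum_comp π (fun l => (U (π.symm l) : ℚ) * v l)]
    simp [Equiv.symm_apply_apply]
  rw [hre, ← hf v hv]
  exact hU (fun l => v (π l)) (hrays v hv)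


/-! ## Sources of safe rays: subadditive length functions on the weight group (appended, leafhand-4 g5)

Every non-negative SUBADDITIVE function `D : A → ℚ` (`D (a + b) ≤ D a + D b`, `D 0 = 0`) gives a substitution-safe vector
`v = D ∘ c` (`v l = D (c l)`): for an exponent `u` of weight `c l₀`, `D (c l₀) = D (Σ u l • c l) ≤ Σ u l * D (c l) = ⟨u, v⟩`. The cube ray of
`k ∈ (ℤ/r)ˣ` is `D_k a = {k a / r}` (fractional part), the corner is the discrete length `D a = 1 (a ≠ 0)`; conversely a safe `v` is `d_v ∘ c` for the
shortest-path length `d_v` it induces on `A`, so the safe cone is exactly the image of the cone of subadditive lengths. This is the handle by which a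
future proof of the ladder theorem (L2 of memo MEMO-15317-leafhand4-g5) certifies that a candidate ray is safe. -/

/-- A subadditive function with `D 0 = 0` satisfies `D (n • a) ≤ n * D a`. [folklore] -/
theorem apply_nsmul_le_of_subadditive (D : A → ℚ) (hD0 : D 0 = 0) (hD : ∀ a b, D (a + b) ≤ D a + D b)
    (a : A) (k : ℕ) : D (k • a) ≤ (k : ℚ) * D a := by
  induction k with
  | zero => simp [hD0]
  | succ k ih =>
    rw [succ_nsmul, Nat.cast_succ, add_mul, one_mul]
    exact (hD _ _).trans (by linarith)

/-- A subadditive function with `D 0 = 0` is subadditive over finite sums: `D (Σ_{l ∈ s} g l) ≤ Σ_{l ∈ s} D (g l)`. [folklore] -/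
theorem apply_sum_le_of_subadditive {ι : Type} (D : A → ℚ) (hD0 : D 0 = 0) (hD : ∀ a b, D (a + b) ≤ D a + D b)
    (s : Finset ι) (g : ι → A) : D (∑ l ∈ s, g l) ≤ ∑ l ∈ s, D (g l) := by
  classical
  induction s using Finset.induction_on with
  | empty => simp [hD0]
  | @insert i s hi ih =>
    rw [Finset.sum_insert hi, Finset.sum_insert hi]
    exact (hD _ _).trans (by linarith)

/-- **Subadditive lengths give substitution-safe rays.** If `D : A → ℚ` is subadditive with `D 0 = 0`, then `v = D ∘ c` satisfies the
substitution inequality `v l₀ ≤ ⟨u, v⟩` for every exponent `u` of weight `c l₀` (no non-negativity and no lattice hypothesis needed for the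
inequality itself). [folklore; cite: Fulton1993Toric, §2.6] -/
theorem safe_of_subadditive (D : A → ℚ) (hD0 : D 0 = 0) (hD : ∀ a b, D (a + b) ≤ D a + D b) (c : Fin n → A) :
    ∀ (u : Fin n → ℕ) (l₀ : Fin n), ∑ l, u l • c l = c l₀ →
      (fun l => D (c l)) l₀ ≤ ∑ l, (u l : ℚ) * (fun l => D (c l)) l := by
  intro u l₀ hu
  simp only
  rw [← hu]
  refine (apply_sum_le_of_subadditive D hD0 hD Finset.univ (fun l => u l • c l)).trans ?_
  exact Finset.sum_le_sum fun l _ => apply_nsmul_le_of_subadditive D hD0 hD (c l) (u l)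

/-- **Safe rays realise the minimum of their weight class**: if `v` is substitution-safe and an exponent `u` of weight `c l₀` has
`⟨u, v⟩ ≤ v l₀`, then `⟨u, v⟩ = v l₀` (so `v l₀` is the shortest-path length `d_v (c l₀)` of the weight class of `l₀`). [folklore] -/
theorem sum_mul_eq_apply_of_safe_of_le (c : Fin n → A) (v : Fin n → ℚ)
    (hsafe : ∀ (u : Fin n → ℕ) (l₀ : Fin n), ∑ l, u l • c l = c l₀ → v l₀ ≤ ∑ l, (u l : ℚ) * v l)
    (u : Fin n → ℕ) (l₀ : Fin n) (hu : ∑ l, u l • c l = c l₀) (hle : ∑ l, (u l : ℚ) * v l ≤ v l₀) :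
    ∑ l, (u l : ℚ) * v l = v l₀ :=
  le_antisymm hle (hsafe u l₀ hu)


/-! ## The safe parallelotope lemma (appended, leafhand-4 g5): safety propagates along the ladder

The cube lemma of `…SubstitutionClosedCentres` is the case `q = 0` of: **if `p = q + t ∈ N` with `q` substitution-safe and
`0 ≤ t l`, `t l₀ < 1`, then `p` satisfies the substitution inequality at `l₀`** (`⟨u, p⟩ ≥ ⟨u, q⟩ ≥ q l₀ = p l₀ - t l₀ > p l₀ - 1` and
`⟨u, p⟩ ≡ p l₀ (mod ℤ)`). Consequently EVERY lattice point of the half-open parallelotope of a simplicial cone generated by coordinate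
vectors and safe rays is safe (`t` = the coordinate part, `q` = the non-negative combination of the safe generators), so the invariant
"all non-coordinate rays are substitution-safe" is preserved by every star subdivision at a parallelotope lattice point (and at sums of safe
rays): lemma (a′) of memo MEMO-15317-leafhand4-g5 §5.5. What remains of the ladder theorem (L2) is purely the Γ-equivariant termination. -/

/-- **Safe parallelotope lemma (pointwise).** Weights `c`, `q` substitution-safe, `t ≥ 0` with `t l₀ < 1`, and `p = q + t` a point of the
dual lattice `N` (integral pairing with the weight-`0` integer exponents). Then `p l₀ ≤ ⟨u, p⟩` for every exponent `u` of weight `c l₀`.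
[folklore; cite: Fulton1993Toric, §2.6] -/
theorem apply_le_sum_of_weight_eq_of_safe_add (c : Fin n → A) (q t : Fin n → ℚ)
    (hq : ∀ (u : Fin n → ℕ) (l₀ : Fin n), ∑ l, u l • c l = c l₀ → q l₀ ≤ ∑ l, (u l : ℚ) * q l)
    (ht0 : ∀ l, 0 ≤ t l)
    (hpN : ∀ m : Fin n → ℤ, ∑ l, m l • c l = 0 → ∃ z : ℤ, ∑ l, (m l : ℚ) * (q + t) l = z)
    (u : Fin n → ℕ) (l₀ : Fin n) (hl₀ : t l₀ < 1) (hu : ∑ l, u l • c l = c l₀) :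
    (q + t) l₀ ≤ ∑ l, (u l : ℚ) * (q + t) l := by
  classical
  -- the integer exponent `u - e_{l₀}` has weight `0`
  have hw : ∑ l, (fun l => (u l : ℤ) - if l = l₀ then 1 else 0) l • c l = 0 := by
    simp only [sub_smul, Finset.sum_sub_distrib, ite_smul, one_smul, zero_smul, Finset.sum_ite_eq',
      Finset.mem_univ, if_true, natCast_zsmul, hu, sub_self]
  obtain ⟨z, hz⟩ := hpN _ hw
  have hz' : ∑ l, (u l : ℚ) * (q + t) l - (q + t) l₀ = z := by
    rw [← hz]
    simp only [Int.cast_sub, Int.cast_natCast, sub_mul, Finset.sum_sub_distrib]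
    congr 1
    rw [Finset.sum_eq_single l₀]
    · simp
    · intro b _ hb
      simp [hb]
    · intro h
      exact absurd (Finset.mem_univ l₀) h
  -- `⟨u, p⟩ = ⟨u, q⟩ + ⟨u, t⟩ ≥ q l₀ + 0`
  have hsplit : ∑ l, (u l : ℚ) * (q + t) l = ∑ l, (u l : ℚ) * q l + ∑ l, (u l : ℚ) * t l := by
    rw [← Finset.sum_add_distrib]
    exact Finset.sum_congr rfl fun l _ => by rw [Pi.add_apply, mul_add]
  have hT : 0 ≤ ∑ l, (u l : ℚ) * t l := Finset.sum_nonneg fun l _ => mul_nonneg (Nat.cast_nonneg _) (ht0 l)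
  have hQ := hq u l₀ hu
  have hge : q l₀ ≤ ∑ l, (u l : ℚ) * (q + t) l := by rw [hsplit]; linarith
  -- hence `z > -1`, so `z ≥ 0`
  have hzpos : (-1 : ℤ) < z := by
    have h : (-1 : ℚ) < z := by
      rw [← hz']
      have : (q + t) l₀ = q l₀ + t l₀ := rfl
      linarith
    exact_mod_cast h
  have hz0 : (0 : ℤ) ≤ z := by omega
  have hz0' : (0 : ℚ) ≤ z := by exact_mod_cast hz0
  linarith

/-- **Parallelotope points of a cone generated by coordinate vectors and safe rays are safe.** If `p ∈ N` decomposes as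
`p = t + Σ_{j ∈ J} s j • g j` with `0 ≤ t l < 1` for all `l` (the part along the coordinate generators), `s j ≥ 0` and every `g j`
substitution-safe, then `p` is substitution-safe. In particular a star subdivision at any lattice point of the half-open parallelotope
of such a cone only creates safe rays — lemma (a′) of the ladder theorem. [folklore; cite: KempfEtAl1973, Ch. I §2 Thm. 11] -/
theorem safe_of_parallelotope_decomposition {ι : Type} (J : Finset ι) (c : Fin n → A) (g : ι → Fin n → ℚ) (s : ι → ℚ)
    (t p : Fin n → ℚ) (hs : ∀ j ∈ J, 0 ≤ s j)
    (hg : ∀ j ∈ J, ∀ (u : Fin n → ℕ) (l₀ : Fin n), ∑ l, u l • c l = c l₀ → g j l₀ ≤ ∑ l, (u l : ℚ) * g j l)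
    (ht0 : ∀ l, 0 ≤ t l) (ht1 : ∀ l, t l < 1) (hp : p = (∑ j ∈ J, s j • g j) + t)
    (hpN : ∀ m : Fin n → ℤ, ∑ l, m l • c l = 0 → ∃ z : ℤ, ∑ l, (m l : ℚ) * p l = z) :
    ∀ (u : Fin n → ℕ) (l₀ : Fin n), ∑ l, u l • c l = c l₀ → p l₀ ≤ ∑ l, (u l : ℚ) * p l := by
  intro u l₀ hu
  subst hp
  exact apply_le_sum_of_weight_eq_of_safe_add c (∑ j ∈ J, s j • g j) t (safe_sum J c g s hs hg) ht0 hpN u l₀ (ht1 l₀) hu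

end Summit.ResolutionOfSingularities.ResolutionOfSingularities.Theorems.FRationalResolution.SafeRayCentreStable
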